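import Mathlib
import HarnessLib
import Summits.QuantumFields.YangMills.Theorems.HypercubicLimit.Negative.ReflectedDensity
import Summits.QuantumFields.YangMills.Theorems.FradkinShenkerFlowFiniteSusceptibilityWeakCouplingRPCauchySchwarz
import Summits.QuantumFields.YangMills.Theorems.LangevinControlUVOSLegsFromFemtoAndGapStubAssemblyLatticeDist
import Summits.QuantumFields.YangMills.Theorems.LangevinControlUVOSLegsFromFemtoAndGapStubAssemblyShiftDefect
import Summits.QuantumFields.YangMills.Theorems.LangevinControlUVOSLegsFromFemtoAndGapStubAssemblyUniformBoundPrep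
import Summits.QuantumFields.YangMills.Theorems.LangevinControlUVOSLegsFromFemtoAndGapStubAssemblyLatticeSums
import Summits.QuantumFields.YangMills.Theorems.LangevinControlUVOSLegsFromFemtoAndGapStubAssemblyWeightBounds
import Literature.MathematicalPhysics.AQFT.OSAxiomsSchwinger
import Literature.MathematicalPhysics.QuantumFieldTheory.OSData
import Literature.MathematicalPhysics.QuantumLattice.LatticeScalarField
import Literature.MathematicalPhysics.QuantumFieldTheory.LatticeGaugeStaticPotentialProofs
import Literature.Probability.LatticeModels.ThermodynamicLimit

/-!
# Block SLICE of line `conditional-mean-telescoping` (crux stmt-QuantumFields-8646): the boundary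
slice of the box is `O(a)` by Schwartz decay

For abstract real weights `W` on multi-indices `x : Fin n → ℤ⁴` with sup bound `|W x| ≤ Mⁿ`, spacing
`0 < a ≤ 1` and half-side `L ≥ a⁻²`, the part of the weighted lattice sum `∑ₓ W(x) F(a x)` over the
multi-indices of the box `(box 4 L)ⁿ` OUTSIDE a sub-domain `D`, all of which have a corner `x l` of
sup norm `≥ L`, is at most `Mⁿ · 2^{16n+2} · Zⁿ · S_{10n+1,0}(F) · a` with the universal lattice
Riemann-sum constant `Z = 81 ∑ₘ (m+1)⁻²`.

Proof.  For such an `x` the physical point `y = (a • siteToE (x i))ᵢ` has `‖y‖ ≥ ‖y l‖ ≥ a ‖x l‖ ≥ a L ≥ a⁻¹ ≥ 1`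
(`mul_norm_le_norm_smul_siteToE`).  Schwartz decay of order `10n+1` (`pow_mul_norm_le_seminorm`) gives
`‖F y‖ ≤ S ‖y‖^{-(10n+1)}`; split `‖y‖^{-(10n+1)} = ‖y‖^{-4n} ‖y‖^{-1} ‖y‖^{-6n} ≤ a^{4n} · a · 2^{6n} (1+‖y‖)^{-6n}`
and `(1+‖y‖)^{-6n} ≤ ∏ᵢ ((1 + a‖xᵢ‖)⁶)⁻¹` (`inv_one_add_norm_pow_le_prod`).  Summing the nonnegative
majorant over the whole box, `∑ₓ ∏ᵢ a⁴ (1 + a‖xᵢ‖)⁻⁶ ≤ Zⁿ` (`sum_prod_decay_le`), and `2^{6n} ≤ 2^{16n+2}`.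
-/

noncomputable section

open scoped SchwartzMap ComplexConjugate
open MeasureTheory Filter Topology
open Literature.MathematicalPhysics.AQFT Literature.MathematicalPhysics.QuantumLattice
open Literature.MathematicalPhysics.QuantumFieldTheory
open Literature.Probability.LatticeModels (box Site)
open Summit.QuantumFields.YangMills.Theorems.HypercubicLimit.Negative (torusPlaquette thetaZ)
open Summit.QuantumFields.YangMills.Theorems.OSLegsFromFemtoAndGap (latticeDist torusMoment)

namespace Summit.QuantumFields.YangMills.Cruxes.HypercubicLimit.ConditionalMeanTelescoping

/-- (auxiliary, block SLICE) **Far zone in physical units.** If a corner `x l` has lattice sup norm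
`≥ L ≥ a⁻²`, then the physical point `y = (a • siteToE (x i))ᵢ` has `‖y‖ ≥ a⁻¹`. [folklore] -/
theorem slice_inv_le_norm {n L : ℕ} {a : ℝ} (ha : 0 < a) (hLa : a⁻¹ * a⁻¹ ≤ L) (x : Fin n → Site 4)
    {l : Fin n} (hl : (L : ℝ) ≤ ‖x l‖) :
    a⁻¹ ≤ ‖(fun i => a • siteToE (x i) : Fin n → EuclideanSpace ℝ (Fin 4))‖ := by
  have h1 : a * ‖x l‖ ≤ ‖a • siteToE (x l)‖ :=
    Summit.QuantumFields.YangMills.Theorems.OSLegsFromFemtoAndGap.mul_norm_le_norm_smul_siteToE ha.le (x l)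
  have h2 : ‖a • siteToE (x l)‖ ≤ ‖(fun i => a • siteToE (x i) : Fin n → EuclideanSpace ℝ (Fin 4))‖ :=
    norm_le_pi_norm (fun i => a • siteToE (x i) : Fin n → EuclideanSpace ℝ (Fin 4)) l
  have h3 : a⁻¹ ≤ (L : ℝ) * a := by
    have := mul_le_mul_of_nonneg_right hLa ha.le
    rwa [mul_assoc, inv_mul_cancel₀ ha.ne', mul_one] at this
  have h4 : (L : ℝ) * a ≤ a * ‖x l‖ := by nlinarith
  linarith

/-- (auxiliary, block SLICE) **Per-point bound in the far zone.** If `‖y‖ ≥ a⁻¹` for the physical point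
`y = (a • siteToE (x i))ᵢ` (`0 < a ≤ 1`) and `|w| ≤ Mⁿ`, then
`|w| ‖F y‖ ≤ Mⁿ 2^{6n} S_{10n+1,0}(F) · a · ∏ᵢ a⁴ (1 + a‖xᵢ‖)⁻⁶` (Schwartz decay of order `10n+1`). [folklore] -/
theorem slice_abs_mul_norm_le {n : ℕ} {M a : ℝ} (hM : 0 ≤ M) (ha : 0 < a) (ha1 : a ≤ 1)
    (F : 𝓢((Fin n → EuclideanSpace ℝ (Fin 4)), ℂ)) (x : Fin n → Site 4) {w : ℝ} (hw : |w| ≤ M ^ n)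
    (hy : a⁻¹ ≤ ‖(fun i => a • siteToE (x i) : Fin n → EuclideanSpace ℝ (Fin 4))‖) :
    |w| * ‖F (fun i => a • siteToE (x i))‖ ≤
      M ^ n * 2 ^ (6 * n) * SchwartzMap.seminorm ℂ (10 * n + 1) 0 F * a *
        ∏ i, (a ^ 4 * ((1 + a * ‖x i‖) ^ 6)⁻¹) := by
  set y : Fin n → EuclideanSpace ℝ (Fin 4) := fun i => a • siteToE (x i) with hy_def
  set t := ‖y‖ with ht
  set S := SchwartzMap.seminorm ℂ (10 * n + 1) 0 F with hS
  have hS0 : 0 ≤ S := apply_nonneg _ _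
  have hainv : (1 : ℝ) ≤ a⁻¹ := one_le_inv_iff₀.2 ⟨ha, ha1⟩
  have ht1 : 1 ≤ t := hainv.trans hy
  have htpos : 0 < t := by linarith
  have hat : 1 ≤ a * t := by
    have := mul_le_mul_of_nonneg_left hy ha.le
    rwa [mul_inv_cancel₀ ha.ne'] at this
  -- Schwartz decay of order `10 n + 1`
  have hdecay : t ^ (10 * n + 1) * ‖F y‖ ≤ S :=
    Summit.QuantumFields.YangMills.Theorems.OSLegsFromFemtoAndGap.pow_mul_norm_le_seminorm F (10 * n + 1) y
  -- `(1+t)^{6n} ≤ 2^{6n} t^{6n}` and `1 ≤ (a t)^{4n+1}`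
  have h1t : (1 + t) ^ (6 * n) ≤ (2 : ℝ) ^ (6 * n) * t ^ (6 * n) := by
    rw [← mul_pow]; exact pow_le_pow_left₀ (by positivity) (by linarith) _
  have h2t : (1 : ℝ) ≤ (a * t) ^ (4 * n + 1) := one_le_pow₀ hat
  -- `‖F y‖ (1+t)^{6n} ≤ 2^{6n} a^{4n+1} S`
  have hmain : ‖F y‖ * (1 + t) ^ (6 * n) ≤ 2 ^ (6 * n) * a ^ (4 * n + 1) * S := by
    calc ‖F y‖ * (1 + t) ^ (6 * n) ≤ ‖F y‖ * ((2 : ℝ) ^ (6 * n) * t ^ (6 * n)) := by gcongr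
      _ ≤ ‖F y‖ * ((2 : ℝ) ^ (6 * n) * t ^ (6 * n)) * (a * t) ^ (4 * n + 1) :=
          le_mul_of_one_le_right (by positivity) h2t
      _ = 2 ^ (6 * n) * a ^ (4 * n + 1) * (t ^ (10 * n + 1) * ‖F y‖) := by
          rw [mul_pow]; ring
      _ ≤ 2 ^ (6 * n) * a ^ (4 * n + 1) * S := by gcongr
  -- the product weight
  have hq : 0 < (1 + t) ^ (6 * n) := by positivity
  have hP : ((1 + t) ^ (6 * n))⁻¹ ≤ ∏ i, ((1 + a * ‖x i‖) ^ 6)⁻¹ := by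
    have := Summit.QuantumFields.YangMills.Theorems.OSLegsFromFemtoAndGap.inv_one_add_norm_pow_le_prod
      ha.le x y (fun i =>
        Summit.QuantumFields.YangMills.Theorems.OSLegsFromFemtoAndGap.mul_norm_le_norm_smul_siteToE
          ha.le (x i)) 6
    rw [inv_pow, ← pow_mul] at this
    exact this
  have hP0 : 0 ≤ ∏ i, ((1 + a * ‖x i‖) ^ 6)⁻¹ := Finset.prod_nonneg fun i _ => by positivity
  have h4 : a ^ (4 * n) * ∏ i, ((1 + a * ‖x i‖) ^ 6)⁻¹ = ∏ i, (a ^ 4 * ((1 + a * ‖x i‖) ^ 6)⁻¹) := by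
    rw [Finset.prod_mul_distrib, Finset.prod_const, Finset.card_univ, Fintype.card_fin, pow_mul]
  have hFy : ‖F y‖ ≤ 2 ^ (6 * n) * a ^ (4 * n + 1) * S * ((1 + t) ^ (6 * n))⁻¹ := by
    rw [← div_eq_mul_inv, le_div_iff₀ hq]; exact hmain
  have hwn : 0 ≤ |w| := abs_nonneg _
  calc |w| * ‖F y‖ ≤ M ^ n * (2 ^ (6 * n) * a ^ (4 * n + 1) * S * ((1 + t) ^ (6 * n))⁻¹) := by gcongr
    _ ≤ M ^ n * (2 ^ (6 * n) * a ^ (4 * n + 1) * S * ∏ i, ((1 + a * ‖x i‖) ^ 6)⁻¹) := by gcongr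
    _ = M ^ n * 2 ^ (6 * n) * S * a * (a ^ (4 * n) * ∏ i, ((1 + a * ‖x i‖) ^ 6)⁻¹) := by
        rw [pow_succ]; ring
    _ = M ^ n * 2 ^ (6 * n) * S * a * ∏ i, (a ^ 4 * ((1 + a * ‖x i‖) ^ 6)⁻¹) := by rw [h4]

/-- **Block SLICE (the boundary slice of the box is `O(a)` by Schwartz decay).** For abstract real
weights with sup bound `Mⁿ`, spacing `0 < a ≤ 1` and half-side `L ≥ a⁻²`, the part of the weighted sum
`∑ W(x) F(a x)` over multi-indices of the box OUTSIDE a sub-domain `D` whose complement lies in the far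
zone (`‖x l‖ ≥ L` for some `l`) is at most `Mⁿ · 2^{16n+2} · Zⁿ · |F|_{10n+1,0} · a`. -/
theorem rpBlock_boundarySlice :
    ∀ (n L : ℕ) (M a : ℝ) (W : (Fin n → Site 4) → ℝ) (D : Finset (Fin n → Site 4))
      (F : 𝓢((Fin n → EuclideanSpace ℝ (Fin 4)), ℂ)),
      0 ≤ M → (∀ x, |W x| ≤ M ^ n) → 0 < a → a ≤ 1 → a⁻¹ * a⁻¹ ≤ L →
      D ⊆ Fintype.piFinset (fun _ : Fin n => box 4 L) →
      (∀ x ∈ Fintype.piFinset (fun _ : Fin n => box 4 L), x ∉ D → ∃ l, (L : ℝ) ≤ ‖x l‖) →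
        ‖∑ x ∈ Fintype.piFinset (fun _ : Fin n => box 4 L) \ D,
            ((W x : ℝ) : ℂ) * F (fun l => a • siteToE (x l))‖ ≤
          M ^ n * 2 ^ (16 * n + 2) * (81 * ∑' m : ℕ, (((m : ℝ) + 1) ^ 2)⁻¹) ^ n *
            SchwartzMap.seminorm ℂ (10 * n + 1) 0 F * a := by
  intro n L M a W D F hM hW ha ha1 hLa hD hfar
  classical
  set B := Fintype.piFinset (fun _ : Fin n => box 4 L) with hB
  set S := SchwartzMap.seminorm ℂ (10 * n + 1) 0 F with hS
  set Z : ℝ := 81 * ∑' m : ℕ, (((m : ℝ) + 1) ^ 2)⁻¹ with hZ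
  set g : (Fin n → Site 4) → ℝ := fun x => ∏ i, (a ^ 4 * ((1 + a * ‖x i‖) ^ 6)⁻¹) with hg
  have hS0 : 0 ≤ S := apply_nonneg _ _
  have hg0 : ∀ x, 0 ≤ g x := fun x => Finset.prod_nonneg fun i _ => by positivity
  have hK0 : 0 ≤ M ^ n * 2 ^ (6 * n) * S * a := by positivity
  -- the per-point bound on the slice
  have hpt : ∀ x ∈ B \ D, ‖((W x : ℝ) : ℂ) * F (fun l => a • siteToE (x l))‖ ≤
      M ^ n * 2 ^ (6 * n) * S * a * g x := by
    intro x hx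
    rw [Finset.mem_sdiff] at hx
    obtain ⟨l, hl⟩ := hfar x hx.1 hx.2
    rw [norm_mul, Complex.norm_real, Real.norm_eq_abs]
    exact slice_abs_mul_norm_le hM ha ha1 F x (hW x) (slice_inv_le_norm ha hLa x hl)
  -- `2^{6n} ≤ 2^{16n+2}`
  have h2pow : (2 : ℝ) ^ (6 * n) ≤ 2 ^ (16 * n + 2) := pow_le_pow_right₀ (by norm_num) (by omega)
  calc ‖∑ x ∈ B \ D, ((W x : ℝ) : ℂ) * F (fun l => a • siteToE (x l))‖
      ≤ ∑ x ∈ B \ D, ‖((W x : ℝ) : ℂ) * F (fun l => a • siteToE (x l))‖ := norm_sum_le _ _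
    _ ≤ ∑ x ∈ B \ D, M ^ n * 2 ^ (6 * n) * S * a * g x := Finset.sum_le_sum hpt
    _ ≤ ∑ x ∈ B, M ^ n * 2 ^ (6 * n) * S * a * g x :=
        Finset.sum_le_sum_of_subset_of_nonneg Finset.sdiff_subset fun x _ _ =>
          mul_nonneg hK0 (hg0 x)
    _ = M ^ n * 2 ^ (6 * n) * S * a * ∑ x ∈ B, g x := by rw [Finset.mul_sum]
    _ ≤ M ^ n * 2 ^ (6 * n) * S * a * Z ^ n := by
        refine mul_le_mul_of_nonneg_left ?_ hK0
        rw [hZ, hg, hB]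
        exact Summit.QuantumFields.YangMills.Theorems.OSLegsFromFemtoAndGap.sum_prod_decay_le ha ha1
          (le_refl 6) (box 4 L) n
    _ ≤ M ^ n * 2 ^ (16 * n + 2) * S * a * Z ^ n := by gcongr
    _ = M ^ n * 2 ^ (16 * n + 2) * Z ^ n * S * a := by ring

end Summit.QuantumFields.YangMills.Cruxes.HypercubicLimit.ConditionalMeanTelescoping

end
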